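import Literature.AlgebraicGeometry.Resolution.PlaneChartEndomorphism
import Literature.RingTheory.Length.ColengthFinrank
import HarnessLib

/-!
# Near points of high contact under the chart endomorphism of `κ⟦x, y⟧`

`Literature/AlgebraicGeometry/Resolution/PlaneChartNearPoint.lean`, continuing
`PlaneChartEndomorphism.lean` (same namespace). Let `Θ` be the chart endomorphism `X i ↦ X i`,
`X j ↦ X i (X j + t)` of `R = κ⟦X₀, X₁⟧`, let `g ∈ 𝔪ᵖ⁺¹` have a non-zero coefficient in degree `p + 1`,
and write `Θ g = (X i)ᵖ · T` (the transform of `g` divided by one power of `X i` LESS than its order: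
`T = X i · (strict transform)`). Suppose the point `t` of the exceptional line is a point of HIGH
CONTACT: the coefficients of `X i · X jᵏ` in `T` vanish for all `k < p` (for the blow-up dynamics of
`z^p = g` this is "the successor has multiplicity `p` and cleaned order `≥ p + 1`"). By the leading
slice formula these coefficients are the Taylor coefficients at `t` of the dehomogenised leading form
`P` of `g`, so `t` is a root of `P` of multiplicity `≥ p` while `deg P ≤ p + 1`. PROVED consequences:

* `taylor_eq_of_nearPoint` — `taylor t P = πₚ Xᵖ + πₚ₊₁ Xᵖ⁺¹` with `(πₚ, πₚ₊₁) ≠ 0`;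
* `coeff_ne_zero_or_of_nearPoint` — back at `t = 0`: the coefficient of `X jᵖ⁺¹` or of `X i X jᵖ` in
  `g` is non-zero (the OTHER point `X i = 0` of the exceptional line is a root of the leading form of
  multiplicity `≤ 1`) — this is what makes Huneke–Swanson's transversality hypothesis available for the
  gradient ideal of `g`;
* `finrank_quotient_span_sup_span_X_le_of_nearPoint` — for any `D` whose `X i`-free slice is the
  `X i`-linear slice of `T` (e.g. `D = ∂T/∂X i`): `dim_κ R/((D) + (X i)) ≤ p + 1` (the local
  intersection number of `D` with the exceptional line at the near point is the root multiplicity).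

Elementary (Taylor expansion of a polynomial of degree `p + 1` with a root of multiplicity `≥ p`);
no named source beyond the blow-up calculus of Casas-Alvero, *Singular Points of Plane Curves* (2000),
§3.2. Everything is PROVED; no definitions.

## References
* [HunekeSwanson2006] C. Huneke, I. Swanson, Integral Closure of Ideals, Rings, and Modules, CUP 2006, §14.1.
-/

noncomputable section

open MvPowerSeries IsLocalRing Finsupp Module
open Literature.RingTheory.MvPowerSeries.Jets Literature.RingTheory.Length

namespace Literature.AlgebraicGeometry.Resolution.PlaneChart

universe u

variable {κ : Type u} [Field κ]

section NearPoint

variable {i j : Fin 2} (hij : j ≠ i) (t : κ)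
  (Θ : MvPowerSeries (Fin 2) κ →ₐ[κ] MvPowerSeries (Fin 2) κ)
  (hΘi : Θ (X i) = X i) (hΘj : Θ (X j) = X i * (X j + C t))
  {p : ℕ} {g T : MvPowerSeries (Fin 2) κ}
  (hg : g ∈ maximalIdeal (MvPowerSeries (Fin 2) κ) ^ (p + 1))
  (hT : Θ g = X i ^ p * T)
  (hvan : ∀ k, k < p → coeff (single i 1 + single j k) T = 0)
  (hne : ∃ l, l ≤ p + 1 ∧ coeff (single i (p + 1 - l) + single j l) g ≠ 0)

include hij hΘi hΘj hg hT in
/-- The `X i`-linear slice of `T` is the Taylor expansion at `t` of the dehomogenised leading form of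
`g`. [folklore] -/
theorem coeff_slice_eq_taylor (k : ℕ) :
    coeff (single i 1 + single j k) T =
      (Polynomial.taylor t (∑ l ∈ Finset.range (p + 1 + 1),
        Polynomial.C (coeff (single i (p + 1 - l) + single j l) g) * Polynomial.X ^ l)).coeff k := by
  rw [← coeff_leading_slice_eq_taylor hij t Θ hΘi hΘj hg k, hT,
    show (single i (p + 1) + single j k : Fin 2 →₀ ℕ) = single i p + (single i 1 + single j k) by
      rw [← add_assoc, ← single_add],
    coeff_single_add_X_pow_mul]

include hij hΘi hΘj hg hT hvan hne in
/-- **Taylor expansion at a near point of high contact.** With `P` the dehomogenised leading form of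
`g` (degree `≤ p + 1`, non-zero): `taylor t P = πₚ Xᵖ + πₚ₊₁ Xᵖ⁺¹` and `(πₚ, πₚ₊₁) ≠ (0, 0)`, where
`πₖ` is the coefficient of `X i X jᵏ` in `T`. [folklore] -/
theorem taylor_eq_of_nearPoint :
    Polynomial.taylor t (∑ l ∈ Finset.range (p + 1 + 1),
        Polynomial.C (coeff (single i (p + 1 - l) + single j l) g) * Polynomial.X ^ l) =
      Polynomial.C (coeff (single i 1 + single j p) T) * Polynomial.X ^ p +
        Polynomial.C (coeff (single i 1 + single j (p + 1)) T) * Polynomial.X ^ (p + 1) ∧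
    (coeff (single i 1 + single j p) T ≠ 0 ∨ coeff (single i 1 + single j (p + 1)) T ≠ 0) := by
  set P : Polynomial κ := ∑ l ∈ Finset.range (p + 1 + 1),
    Polynomial.C (coeff (single i (p + 1 - l) + single j l) g) * Polynomial.X ^ l with hP
  have hslice : ∀ k, (Polynomial.taylor t P).coeff k = coeff (single i 1 + single j k) T := fun k =>
    (coeff_slice_eq_taylor hij t Θ hΘi hΘj hg hT k).symm
  have hPcoeff : ∀ l, P.coeff l = if l < p + 1 + 1 then coeff (single i (p + 1 - l) + single j l) g else 0 := by
    intro l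
    rw [hP, Polynomial.finsetSum_coeff]
    simp_rw [Polynomial.coeff_C_mul_X_pow]
    rw [Finset.sum_ite_eq (Finset.range (p + 1 + 1)) l]
    simp only [Finset.mem_range]
  have hPdeg : P.natDegree ≤ p + 1 := by
    rw [Polynomial.natDegree_le_iff_coeff_eq_zero]
    intro l hl
    rw [hPcoeff, if_neg (by omega)]
  have hP0 : P ≠ 0 := by
    obtain ⟨l, hl, hgl⟩ := hne
    intro h0
    have := hPcoeff l
    rw [h0, Polynomial.coeff_zero, if_pos (by omega)] at this
    exact hgl this.symm
  -- the expansion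
  have hexp : Polynomial.taylor t P =
      Polynomial.C (coeff (single i 1 + single j p) T) * Polynomial.X ^ p +
        Polynomial.C (coeff (single i 1 + single j (p + 1)) T) * Polynomial.X ^ (p + 1) := by
    ext k
    rw [Polynomial.coeff_add, Polynomial.coeff_C_mul_X_pow, Polynomial.coeff_C_mul_X_pow]
    rcases lt_trichotomy k p with hk | rfl | hk
    · rw [hslice, hvan k hk, if_neg hk.ne, if_neg (by omega), add_zero]
    · rw [hslice, if_pos rfl, if_neg (by omega), add_zero]
    · rcases eq_or_lt_of_le (Nat.succ_le_of_lt hk) with hk1 | hk1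
      · rw [← hk1, hslice, if_neg (by omega), if_pos rfl, zero_add]
      · rw [if_neg (by omega), if_neg (by omega), add_zero]
        apply Polynomial.coeff_eq_zero_of_natDegree_lt
        rw [Polynomial.natDegree_taylor]
        omega
  refine ⟨hexp, ?_⟩
  by_contra hboth
  push Not at hboth
  apply hP0
  apply Polynomial.taylor_injective t
  rw [hexp, hboth.1, hboth.2, map_zero, map_zero, zero_mul, zero_mul, add_zero]

include hij hΘi hΘj hg hT hvan hne in
/-- **At a near point of high contact, the point `X i = 0` of the exceptional line has multiplicity
`≤ 1` in the leading form**: the coefficient of `X jᵖ⁺¹` or that of `X i · X jᵖ` in `g` is non-zero.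
[folklore] -/
theorem coeff_ne_zero_or_of_nearPoint :
    coeff (single j (p + 1)) g ≠ 0 ∨ coeff (single i 1 + single j p) g ≠ 0 := by
  obtain ⟨hexp, hπ⟩ := taylor_eq_of_nearPoint hij t Θ hΘi hΘj hg hT hvan hne
  set P : Polynomial κ := ∑ l ∈ Finset.range (p + 1 + 1),
    Polynomial.C (coeff (single i (p + 1 - l) + single j l) g) * Polynomial.X ^ l with hP
  set πp := coeff (single i 1 + single j p) T
  set πq := coeff (single i 1 + single j (p + 1)) T
  -- go back with `taylor (-t)`
  have hback : P = Polynomial.C πp * (Polynomial.X + Polynomial.C (-t)) ^ p +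
      Polynomial.C πq * (Polynomial.X + Polynomial.C (-t)) ^ (p + 1) := by
    have h := congrArg (Polynomial.taylor (-t)) hexp
    rw [Polynomial.taylor_taylor, neg_add_cancel, Polynomial.taylor_zero] at h
    rw [h, map_add, Polynomial.C_mul_X_pow_eq_monomial, Polynomial.C_mul_X_pow_eq_monomial,
      Polynomial.taylor_monomial, Polynomial.taylor_monomial]
  have hPcoeff : ∀ l, P.coeff l = if l < p + 1 + 1 then coeff (single i (p + 1 - l) + single j l) g else 0 := by
    intro l
    rw [hP, Polynomial.finsetSum_coeff]
    simp_rw [Polynomial.coeff_C_mul_X_pow]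
    rw [Finset.sum_ite_eq (Finset.range (p + 1 + 1)) l]
    simp only [Finset.mem_range]
  -- coefficient of `X^{p+1}`: `πq`
  have hc1 : coeff (single j (p + 1)) g = πq := by
    have h1 := hPcoeff (p + 1)
    rw [if_pos (by omega), Nat.sub_self, single_zero, zero_add] at h1
    rw [← h1, hback, Polynomial.coeff_add, Polynomial.coeff_C_mul, Polynomial.coeff_C_mul,
      Polynomial.coeff_X_add_C_pow, Polynomial.coeff_X_add_C_pow, Nat.choose_succ_self, Nat.cast_zero,
      mul_zero, mul_zero, zero_add, Nat.sub_self, pow_zero, Nat.choose_self, Nat.cast_one, mul_one, mul_one]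
  -- coefficient of `X^p`: `πp + πq · (-t) · (p+1)`
  have hc2 : coeff (single i 1 + single j p) g = πp + πq * ((-t) * ((p + 1).choose p : κ)) := by
    have h1 := hPcoeff p
    rw [if_pos (by omega), show p + 1 - p = 1 by omega] at h1
    rw [← h1, hback, Polynomial.coeff_add, Polynomial.coeff_C_mul, Polynomial.coeff_C_mul,
      Polynomial.coeff_X_add_C_pow, Polynomial.coeff_X_add_C_pow, Nat.sub_self, pow_zero, Nat.choose_self,
      Nat.cast_one, mul_one, mul_one, show p + 1 - p = 1 by omega, pow_one]
  rcases hπ with hp0 | hq0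
  · by_cases hq : πq = 0
    · right; rw [hc2, hq, zero_mul, add_zero]; exact hp0
    · left; rw [hc1]; exact hq
  · left; rw [hc1]; exact hq0

include hij hΘi hΘj hg hT hvan hne in
/-- **The exceptional line meets `(D)` with multiplicity `≤ p + 1` at a near point of high contact**,
for every `D` whose `X i`-free slice is the `X i`-linear slice of `T`:
`dim_κ R/((D) + (X i)) ≤ p + 1`. [folklore] -/
theorem finrank_quotient_span_sup_span_X_le_of_nearPoint {D : MvPowerSeries (Fin 2) κ}
    (hD : ∀ k, coeff (single j k) D = coeff (single i 1 + single j k) T) :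
    finrank κ (MvPowerSeries (Fin 2) κ ⧸ (Ideal.span {D} ⊔ Ideal.span {(X i : MvPowerSeries (Fin 2) κ)})) ≤ p + 1 := by
  classical
  obtain ⟨hexp, hπ⟩ := taylor_eq_of_nearPoint hij t Θ hΘi hΘj hg hT hvan hne
  set πp := coeff (single i 1 + single j p) T with hπp
  set πq := coeff (single i 1 + single j (p + 1)) T with hπq
  set L : Ideal (MvPowerSeries (Fin 2) κ) := Ideal.span {D} ⊔ Ideal.span {(X i : MvPowerSeries (Fin 2) κ)} with hL
  -- the slice coefficients: `πₖ = 0` unless `k ∈ {p, p+1}`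
  have hslice : ∀ k, coeff (single i 1 + single j k) T =
      (Polynomial.C πp * Polynomial.X ^ p + Polynomial.C πq * Polynomial.X ^ (p + 1)).coeff k := by
    intro k
    rw [coeff_slice_eq_taylor hij t Θ hΘi hΘj hg hT k, hexp]
  -- `Q = πp X j^p + πq X j^{p+1} ∈ L`
  set Q : MvPowerSeries (Fin 2) κ := C πp * X j ^ p + C πq * X j ^ (p + 1) with hQ
  have hQcoeff : ∀ k, coeff (single j k) Q = (Polynomial.C πp * Polynomial.X ^ p +
      Polynomial.C πq * Polynomial.X ^ (p + 1)).coeff k := by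
    intro k
    have h1 : ∀ (a : κ) (n : ℕ), coeff (single j k) (C a * (X j : MvPowerSeries (Fin 2) κ) ^ n) =
        if k = n then a else 0 := by
      intro a n
      rw [X_pow_eq, ← MvPowerSeries.monomial_zero_eq_C_apply, monomial_mul_monomial, zero_add, mul_one,
        coeff_monomial]
      by_cases hkn : k = n
      · subst hkn; rw [if_pos rfl, if_pos rfl]
      · rw [if_neg (fun h => hkn (single_injective j h)), if_neg hkn]
    rw [hQ, map_add, Polynomial.coeff_add, Polynomial.coeff_C_mul_X_pow, Polynomial.coeff_C_mul_X_pow, h1, h1]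
  have hdvd : (X i : MvPowerSeries (Fin 2) κ) ∣ D - Q := by
    rw [MvPowerSeries.X_dvd_iff]
    intro m hm
    have hmj : m = single j (m j) := by
      rw [eq_single_add_single hij m, hm, single_zero, zero_add]
      simp
    rw [hmj, map_sub, hD, hslice, hQcoeff, sub_self]
  have hQL : Q ∈ L := by
    obtain ⟨W, hW⟩ := hdvd
    have : Q = D - X i * W := by rw [← hW]; ring
    rw [this]
    exact Ideal.sub_mem _ (Ideal.mem_sup_left (Ideal.mem_span_singleton_self _))
      (Ideal.mem_sup_right (Ideal.mem_span_singleton'.mpr ⟨W, by ring⟩))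
  -- hence `X j ^ (p+1) ∈ L`
  have hXjL : (X j : MvPowerSeries (Fin 2) κ) ^ (p + 1) ∈ L := by
    rcases hπ with hp0 | hq0
    · -- `Q = X j^p (πp + πq X j)` with a unit second factor
      have hu : IsUnit (C πp + C πq * X j : MvPowerSeries (Fin 2) κ) := by
        rw [MvPowerSeries.isUnit_iff_constantCoeff, map_add, map_mul, constantCoeff_C, constantCoeff_C,
          constantCoeff_X, mul_zero, add_zero, isUnit_iff_ne_zero]
        exact hp0
      obtain ⟨u, hu'⟩ := hu
      have hXp : (X j : MvPowerSeries (Fin 2) κ) ^ p = Q * ↑u⁻¹ := by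
        rw [hQ, show (C πp * X j ^ p + C πq * X j ^ (p + 1) : MvPowerSeries (Fin 2) κ) =
          X j ^ p * (C πp + C πq * X j) by ring, ← hu', mul_assoc, Units.mul_inv, mul_one]
      rw [pow_succ, hXp]
      exact Ideal.mul_mem_right _ _ (Ideal.mul_mem_right _ _ hQL)
    · by_cases hp0 : πp = 0
      · have : (X j : MvPowerSeries (Fin 2) κ) ^ (p + 1) = Q * C πq⁻¹ := by
          rw [hQ, hp0, map_zero, zero_mul, zero_add, mul_comm (C πq), mul_assoc, ← map_mul,
            mul_inv_cancel₀ hq0, map_one, mul_one]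
        rw [this]; exact Ideal.mul_mem_right _ _ hQL
      · have hu : IsUnit (C πp + C πq * X j : MvPowerSeries (Fin 2) κ) := by
          rw [MvPowerSeries.isUnit_iff_constantCoeff, map_add, map_mul, constantCoeff_C, constantCoeff_C,
            constantCoeff_X, mul_zero, add_zero, isUnit_iff_ne_zero]
          exact hp0
        obtain ⟨u, hu'⟩ := hu
        have hXp : (X j : MvPowerSeries (Fin 2) κ) ^ p = Q * ↑u⁻¹ := by
          rw [hQ, show (C πp * X j ^ p + C πq * X j ^ (p + 1) : MvPowerSeries (Fin 2) κ) =
            X j ^ p * (C πp + C πq * X j) by ring, ← hu', mul_assoc, Units.mul_inv, mul_one]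
        rw [pow_succ, hXp]
        exact Ideal.mul_mem_right _ _ (Ideal.mul_mem_right _ _ hQL)
  -- `𝔪^{p+1} ≤ L`, so `R/L` is finite and spanned by `1, X j, …, X j^p`
  have hmL : maximalIdeal (MvPowerSeries (Fin 2) κ) ^ (p + 1) ≤ L := by
    rw [maximalIdeal_pow_eq_span_monomial, Ideal.span_le]
    rintro _ ⟨e, he, rfl⟩
    rw [Set.mem_setOf_eq] at he
    change monomial e (1 : κ) ∈ L
    rw [monomial_one_eq_X_pow_mul_X_pow hij e]
    by_cases hei : e i = 0
    · have hej : e j = p + 1 := by have := degree_eq_add hij e; omega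
      rw [hei, pow_zero, one_mul, hej]
      exact hXjL
    · obtain ⟨k, hk⟩ := Nat.exists_eq_succ_of_ne_zero hei
      rw [hk, pow_succ, mul_assoc, mul_comm (X i), ← mul_assoc]
      exact Ideal.mul_mem_left _ _ (Ideal.mem_sup_right (Ideal.mem_span_singleton_self _))
  haveI : Module.Finite κ (MvPowerSeries (Fin 2) κ ⧸ L) :=
    haveI := finite_quotient_maximalIdeal_pow (σ := Fin 2) (K := κ) (p + 1)
    finite_quotient_of_le (κ := κ) hmL
  -- `mk (C a * y) = a • mk y`
  have hsm : ∀ (a : κ) (y : MvPowerSeries (Fin 2) κ),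
      Ideal.Quotient.mk L (C a * y) = a • Ideal.Quotient.mk L y := by
    intro a y
    rw [Algebra.smul_def, ← Ideal.Quotient.mk_algebraMap, ← map_mul, MvPowerSeries.c_eq_algebraMap]
  -- spanning family `1, X j, …, X j ^ p`
  have hspan : Submodule.span κ (Set.range fun k : Fin (p + 1) =>
      Ideal.Quotient.mk L ((X j : MvPowerSeries (Fin 2) κ) ^ (k : ℕ))) = ⊤ := by
    rw [eq_top_iff]
    rintro y -
    obtain ⟨f, rfl⟩ := Ideal.Quotient.mk_surjective y
    have hf : Ideal.Quotient.mk L f = Ideal.Quotient.mk L (↑(truncTotal (p + 1) f) : MvPowerSeries (Fin 2) κ) := by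
      rw [Ideal.Quotient.eq]
      exact hmL (sub_coe_truncTotal_mem_maximalIdeal_pow (p + 1) f)
    rw [hf, (truncTotal (p + 1) f).as_sum, ← MvPolynomial.coeToMvPowerSeries.ringHom_apply, map_sum, map_sum]
    refine Submodule.sum_mem _ fun e he => ?_
    rw [MvPolynomial.coeToMvPowerSeries.ringHom_apply, MvPolynomial.coe_monomial]
    have hdeg : e.degree < p + 1 := by
      by_contra hN
      exact (MvPolynomial.mem_support_iff.1 he) (coeff_truncTotal_eq_zero _ (not_lt.mp hN))
    have hmon : monomial e (MvPolynomial.coeff e (truncTotal (p + 1) f)) =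
        C (MvPolynomial.coeff e (truncTotal (p + 1) f)) *
          ((X i : MvPowerSeries (Fin 2) κ) ^ e i * X j ^ e j) := by
      rw [← monomial_one_eq_X_pow_mul_X_pow hij e, ← MvPowerSeries.monomial_zero_eq_C_apply,
        monomial_mul_monomial, zero_add, mul_one]
    rw [hmon, hsm]
    refine Submodule.smul_mem _ _ ?_
    by_cases hei : e i = 0
    · -- a power of `X j` of exponent `< p + 1`
      have hlt : e j < p + 1 := by have := degree_eq_add hij e; omega
      rw [hei, pow_zero, one_mul]
      exact Submodule.subset_span ⟨⟨e j, hlt⟩, rfl⟩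
    · -- a multiple of `X i`, zero in the quotient
      obtain ⟨k, hk⟩ := Nat.exists_eq_succ_of_ne_zero hei
      have h0 : Ideal.Quotient.mk L ((X i : MvPowerSeries (Fin 2) κ) ^ e i * X j ^ e j) = 0 := by
        rw [Ideal.Quotient.eq_zero_iff_mem, hk, pow_succ, mul_assoc, mul_comm (X i), ← mul_assoc]
        exact Ideal.mul_mem_left _ _ (Ideal.mem_sup_right (Ideal.mem_span_singleton_self _))
      rw [h0]; exact Submodule.zero_mem _
  calc finrank κ (MvPowerSeries (Fin 2) κ ⧸ L)
      = finrank κ (⊤ : Submodule κ (MvPowerSeries (Fin 2) κ ⧸ L)) := (finrank_top κ _).symm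
    _ = finrank κ (Submodule.span κ (Set.range fun k : Fin (p + 1) =>
          Ideal.Quotient.mk L ((X j : MvPowerSeries (Fin 2) κ) ^ (k : ℕ)))) := by rw [hspan]
    _ ≤ Fintype.card (Fin (p + 1)) := finrank_range_le_card _
    _ = p + 1 := Fintype.card_fin _

end NearPoint

end Literature.AlgebraicGeometry.Resolution.PlaneChart

end
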